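import Summits.Parity.GeneralizedHardyLittlewood.Theorems.LeeYangFibresFibrationLemmaDisc
import Literature.NumberTheory.Sieve.LinearEquationsInPrimesMultiplicativity
import HarnessLib

/-!
# Translates of one-dimensional systems; rank-one systems
(route `ConstellationCubes`, node RelativeCubes)

Support lemmas for `ConstellationCubesOneClassHLFibration` (`BoundedDickson ⟹ OneClassHL`, item
stmt-Parity-30019 ⟸ item stmt-Parity-13151), on top of the tree's fibre machinery
`Theorems.LeeYangFibresFibrationLemma{Defs,Disc}`:

* §1 *Translation on `ℤ`*: if `Φ'` is the translate `φ'ᵢ(m) = φᵢ(m + c)` of `Φ` (same coefficients,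
  constants `bᵢ + aᵢ c`), then the prime sum, the archimedean factor, the local factors and the singular
  product of `Φ'` over `K` are those of `Φ` over `K + c` (`vonMangoldtSum_transl`, `archFactor_transl`,
  `localFactor_transl`, `singularProduct_transl`); `K + c` is convex and boxed (`convex_transl`,
  `transl_subset_realBox`).
* §2 *Rank-one systems* `ψ̇ᵢ = aᵢ σ` on `ℤ^{d+1}` (`aᵢ = ψ̇ᵢ(e_{d+1}) ≠ 0`): every fibre system `Φ_w` is the
  translate of `Φ₀` by `c(w) = ∑ⱼ σⱼ wⱼ` (`fibreSystem_transl`, `|c(w)| ≤ (∑|σⱼ|) N`), and every base point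
  is good — the pair discriminants are the non-zero constants `aᵢ bⱼ − aⱼ bᵢ` (`discForm_eval_ne_zero`,
  `goodSet_eq_latticeBox`, `isNondegenerateSystem_fibreSystem_zero`).

No new definitions. [cite: GreenTao2010, §1 (remark after Conj. 1.2), (1.4), (1.6)]
-/

open Finset MeasureTheory

namespace Summit.Parity.GeneralizedHardyLittlewood.ConstellationCubesFibreTranslation

open Literature.NumberTheory.Sieve
open Summit.Parity.GeneralizedHardyLittlewood.Theorems

variable {d t : ℕ}

/-! ### §1 Translation of one-dimensional systems -/

/-- Values of a translate: `φ'ᵢ(n) = φᵢ(n + c)`. [folklore] -/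
theorem eval_transl {Φ Φ' : Fin t → AffLinForm 1} {c : ℤ}
    (htr : ∀ i, (Φ' i).coeff = (Φ i).coeff ∧ (Φ' i).const = (Φ i).const + (Φ i).coeff 0 * c)
    (i : Fin t) (n : Fin 1 → ℤ) : (Φ' i).eval n = (Φ i).eval (fun k => n k + c) := by
  obtain ⟨hco, hcs⟩ := htr i
  simp only [AffLinForm.eval, Fin.sum_univ_one, hco, hcs]
  ring

/-- Real values of a translate: `φ'ᵢ(x) = φᵢ(x + c)`. [folklore] -/
theorem realEval_transl {Φ Φ' : Fin t → AffLinForm 1} {c : ℤ}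
    (htr : ∀ i, (Φ' i).coeff = (Φ i).coeff ∧ (Φ' i).const = (Φ i).const + (Φ i).coeff 0 * c)
    (i : Fin t) (x : Fin 1 → ℝ) : (Φ' i).realEval x = (Φ i).realEval (fun k => x k + (c : ℝ)) := by
  obtain ⟨hco, hcs⟩ := htr i
  simp only [AffLinForm.realEval, Fin.sum_univ_one, hco, hcs]
  push_cast
  ring

/-- **Prime sums of a translate**: `∑_{K ∩ ℤ} Λ^{⊗t}(Φ') = ∑_{(K + c) ∩ ℤ} Λ^{⊗t}(Φ)` (for `K ⊆ [-N, N]`,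
the translated body read at any scale `N₁ ≥ N + |c|`). [folklore] -/
theorem vonMangoldtSum_transl {Φ Φ' : Fin t → AffLinForm 1} {c : ℤ}
    (htr : ∀ i, (Φ' i).coeff = (Φ i).coeff ∧ (Φ' i).const = (Φ i).const + (Φ i).coeff 0 * c)
    {K : Set (Fin 1 → ℝ)} {N N₁ : ℕ} (hK : K ⊆ realBox 1 N) (hN₁ : (N : ℤ) + |c| ≤ N₁) :
    vonMangoldtSum Φ' K N = vonMangoldtSum Φ ((fun y => y - fun _ => (c : ℝ)) ⁻¹' K) N₁ := by
  classical
  unfold vonMangoldtSum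
  refine Finset.sum_nbij' (fun n k => n k + c) (fun n k => n k - c) ?_ ?_ ?_ ?_ ?_
  · intro n hn
    rw [Finset.mem_filter] at hn ⊢
    obtain ⟨hbox, hKmem⟩ := hn
    refine ⟨?_, ?_⟩
    · rw [latticeBox, Fintype.mem_piFinset] at hbox ⊢
      intro k
      have h1 := Finset.mem_Icc.mp (hbox k)
      have h2 := neg_abs_le c
      have h3 := le_abs_self c
      exact Finset.mem_Icc.mpr ⟨by linarith, by linarith⟩
    · show (realPoint (fun k => n k + c) - fun _ => (c : ℝ)) ∈ K
      have : (realPoint (fun k => n k + c) - fun _ => (c : ℝ)) = realPoint n := by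
        funext k
        simp [realPoint]
      rw [this]
      exact hKmem
  · intro n hn
    rw [Finset.mem_filter] at hn ⊢
    obtain ⟨-, hKmem⟩ := hn
    have hK' := hK hKmem
    simp only [realBox, Set.mem_Icc, Pi.le_def, Pi.sub_apply, realPoint] at hK'
    refine ⟨?_, ?_⟩
    · rw [latticeBox, Fintype.mem_piFinset]
      intro k
      have h1 := hK'.1 k
      have h2 := hK'.2 k
      refine Finset.mem_Icc.mpr ⟨?_, ?_⟩
      · exact_mod_cast h1
      · exact_mod_cast h2
    · show realPoint (fun k => n k - c) ∈ K
      have : realPoint (fun k => n k - c) = realPoint n - fun _ => (c : ℝ) := by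
        funext k
        simp [realPoint]
      rw [this]
      exact hKmem
  · intro n _
    funext k
    simp
  · intro n _
    funext k
    simp
  · intro n _
    exact Finset.prod_congr rfl fun i _ => by rw [eval_transl htr]

/-- **Archimedean factor of a translate**: `β_∞(Φ', K) = β_∞(Φ, K + c)` (Lebesgue measure is
translation invariant). [cite: GreenTao2010, (1.4)] -/
theorem archFactor_transl {Φ Φ' : Fin t → AffLinForm 1} {c : ℤ}
    (htr : ∀ i, (Φ' i).coeff = (Φ i).coeff ∧ (Φ' i).const = (Φ i).const + (Φ i).coeff 0 * c)
    (K : Set (Fin 1 → ℝ)) :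
    archFactor Φ' K = archFactor Φ ((fun y => y - fun _ => (c : ℝ)) ⁻¹' K) := by
  unfold archFactor
  set v : Fin 1 → ℝ := fun _ => (c : ℝ) with hv
  have hset : (fun y => y - v) ⁻¹' K ∩ {y | ∀ i, 0 < (Φ i).realEval y} =
      (fun y => -v + y) ⁻¹' (K ∩ {x | ∀ i, 0 < (Φ' i).realEval x}) := by
    ext y
    have h2 : ∀ i, (Φ' i).realEval (y - v) = (Φ i).realEval y := fun i => by
      rw [realEval_transl htr]
      congr 1
      funext k
      simp [hv]
    simp only [Set.mem_preimage, Set.mem_inter_iff, Set.mem_setOf_eq, neg_add_eq_sub, h2]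
  rw [hset, measure_preimage_add]

/-- **Local factors of a translate**: `β_q(Φ') = β_q(Φ)` (translation permutes `ℤ/qℤ`).
[cite: GreenTao2010, (1.6)] -/
theorem localFactor_transl {Φ Φ' : Fin t → AffLinForm 1} {c : ℤ}
    (htr : ∀ i, (Φ' i).coeff = (Φ i).coeff ∧ (Φ' i).const = (Φ i).const + (Φ i).coeff 0 * c)
    (q : ℕ) : localFactor Φ' q = localFactor Φ q := by
  rcases Nat.eq_zero_or_pos q with rfl | hq
  · simp [localFactor]
  haveI : NeZero q := ⟨hq.ne'⟩
  rw [localFactor_eq_sum_zmod, localFactor_eq_sum_zmod]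
  congr 1
  refine Fintype.sum_equiv (Equiv.addRight fun _ : Fin 1 => (c : ZMod q)) _ _ fun v => ?_
  refine Finset.prod_congr rfl fun i _ => ?_
  obtain ⟨hco, hcs⟩ := htr i
  simp only [AffLinForm.modEval, Fin.sum_univ_one, hco, hcs, Equiv.coe_addRight, Pi.add_apply]
  push_cast
  ring

/-- **Singular products of a translate**: `𝔖(Φ') = 𝔖(Φ)`. [cite: GreenTao2010, (1.7)] -/
theorem singularProduct_transl {Φ Φ' : Fin t → AffLinForm 1} {c : ℤ}
    (htr : ∀ i, (Φ' i).coeff = (Φ i).coeff ∧ (Φ' i).const = (Φ i).const + (Φ i).coeff 0 * c) :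
    singularProduct Φ' = singularProduct Φ := by
  have h : singularProductPartial Φ' = singularProductPartial Φ := by
    funext x
    unfold singularProductPartial
    exact Finset.prod_congr rfl fun p _ => localFactor_transl htr p
  unfold singularProduct
  rw [h]

/-- The translated body `K + c` is convex if `K` is. [folklore] -/
theorem convex_transl {K : Set (Fin 1 → ℝ)} (hK : Convex ℝ K) (v : Fin 1 → ℝ) :
    Convex ℝ ((fun y => y - v) ⁻¹' K) := by
  intro y hy y' hy' a b ha hb hab
  have h : a • y + b • y' - v = a • (y - v) + b • (y' - v) := by
    calc a • y + b • y' - v = a • y + b • y' - (a + b) • v := by rw [hab, one_smul]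
      _ = a • (y - v) + b • (y' - v) := by rw [add_smul, smul_sub, smul_sub]; abel
  show a • y + b • y' - v ∈ K
  rw [h]
  exact hK hy hy' ha hb hab

/-- The translated body of `K ⊆ [-N, N]` lies in `[-N₁, N₁]` for `N₁ ≥ N + |c|`. [folklore] -/
theorem transl_subset_realBox {K : Set (Fin 1 → ℝ)} {N : ℕ} (hK : K ⊆ realBox 1 N) {c : ℤ} {N₁ : ℕ}
    (hN₁ : (N : ℤ) + |c| ≤ N₁) : (fun y => y - fun _ => (c : ℝ)) ⁻¹' K ⊆ realBox 1 N₁ := by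
  intro y hy
  have hK' := hK hy
  simp only [realBox, Set.mem_Icc, Pi.le_def, Pi.sub_apply] at hK' ⊢
  have hc : ((N : ℤ) : ℝ) + (|c| : ℤ) ≤ ((N₁ : ℤ) : ℝ) := by exact_mod_cast hN₁
  push_cast at hc
  refine ⟨fun k => ?_, fun k => ?_⟩
  · have := hK'.1 k
    linarith [le_abs_self (c : ℝ), neg_abs_le (c : ℝ)]
  · have := hK'.2 k
    linarith [le_abs_self (c : ℝ), neg_abs_le (c : ℝ)]

/-! ### §2 Rank-one systems on `ℤ^{d+1}`: all fibres are translates of one system -/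

/-- **Fibres of a rank-one system are translates.** If `ψ̇ᵢ = aᵢ σ` (`aᵢ = ψ̇ᵢ(e_{d+1})`), the fibre
system over `w` is the translate of the fibre system over `0` by `c(w) = ∑_{j ≤ d} σⱼ wⱼ`.
[cite: GreenTao2010, §1 (remark after Conj. 1.2)] -/
theorem fibreSystem_transl (Ψ : Fin t → AffLinForm (d + 1)) {σ : Fin (d + 1) → ℤ}
    (hσ : ∀ i j, (Ψ i).coeff j = lastCoeff (Ψ i) * σ j) (w : Fin d → ℤ) (i : Fin t) :
    (fibreSystem Ψ w i).coeff = (fibreSystem Ψ 0 i).coeff ∧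
      (fibreSystem Ψ w i).const = (fibreSystem Ψ 0 i).const +
        (fibreSystem Ψ 0 i).coeff 0 * ∑ j, σ (Fin.castSucc j) * w j := by
  refine ⟨rfl, ?_⟩
  simp only [fibreSystem, fibreForm_const, fibreForm_coeff, baseForm, AffLinForm.eval, Pi.zero_apply,
    mul_zero, Finset.sum_const_zero, zero_add, hσ, mul_assoc, ← Finset.mul_sum]
  ring

/-- The shift `c(w)` of a base point `w ∈ [-N, N]^d` is at most `(∑ⱼ |σⱼ|) N`. [folklore] -/
theorem abs_shift_le (σ : Fin (d + 1) → ℤ) {N : ℕ} {w : Fin d → ℤ} (hw : w ∈ latticeBox d N) :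
    |∑ j, σ (Fin.castSucc j) * w j| ≤ ((∑ j, (σ (Fin.castSucc j)).natAbs : ℕ) : ℤ) * N := by
  have hwj : ∀ j, |w j| ≤ N := fun j => by
    have := Fintype.mem_piFinset.mp hw j
    rw [Finset.mem_Icc] at this
    exact abs_le.mpr ⟨this.1, this.2⟩
  calc |∑ j, σ (Fin.castSucc j) * w j| ≤ ∑ j, |σ (Fin.castSucc j) * w j| := Finset.abs_sum_le_sum_abs _ _
    _ ≤ ∑ j, |σ (Fin.castSucc j)| * N := by
        refine Finset.sum_le_sum fun j _ => ?_
        rw [abs_mul]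
        exact mul_le_mul_of_nonneg_left (hwj j) (abs_nonneg _)
    _ = ((∑ j, (σ (Fin.castSucc j)).natAbs : ℕ) : ℤ) * N := by
        rw [← Finset.sum_mul]
        push_cast
        rfl

/-- **All base points of a rank-one system are good**: the pair discriminant `Dᵢⱼ` has zero linear
part, hence is the non-zero constant `aᵢ bⱼ − aⱼ bᵢ` (`Ψ` non-degenerate, `aᵢ ≠ 0`).
[cite: GreenTao2010, Def. 1.1] -/
theorem discForm_eval_ne_zero {Ψ : Fin t → AffLinForm (d + 1)} (hΨ : IsNondegenerateSystem Ψ)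
    (ha : ∀ i, lastCoeff (Ψ i) ≠ 0) {σ : Fin (d + 1) → ℤ}
    (hσ : ∀ i j, (Ψ i).coeff j = lastCoeff (Ψ i) * σ j) (w : Fin d → ℤ) {i j : Fin t} (hij : i ≠ j) :
    (discForm Ψ i j).eval w ≠ 0 := by
  have hcoeff : (discForm Ψ i j).coeff = 0 := by
    funext k
    simp only [discForm, hσ, Pi.zero_apply]
    ring
  rcases discForm_ne_zero hΨ ha hij with h | h
  · exact absurd hcoeff h
  · simpa [AffLinForm.eval, hcoeff] using h

/-- `goodSet = [-N, N]^d` for a rank-one system. [folklore] -/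
theorem goodSet_eq_latticeBox {Ψ : Fin t → AffLinForm (d + 1)} (hΨ : IsNondegenerateSystem Ψ)
    (ha : ∀ i, lastCoeff (Ψ i) ≠ 0) {σ : Fin (d + 1) → ℤ}
    (hσ : ∀ i j, (Ψ i).coeff j = lastCoeff (Ψ i) * σ j) (N : ℕ) : goodSet Ψ N = latticeBox d N := by
  ext w
  rw [mem_goodSet]
  exact ⟨fun h => h.1, fun hw => ⟨hw, fun i j hij => discForm_eval_ne_zero hΨ ha hσ w hij⟩⟩

/-- The fibre system over `0` of a non-degenerate rank-one system is non-degenerate.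
[cite: GreenTao2010, Def. 1.1] -/
theorem isNondegenerateSystem_fibreSystem_zero {Ψ : Fin t → AffLinForm (d + 1)}
    (hΨ : IsNondegenerateSystem Ψ) (ha : ∀ i, lastCoeff (Ψ i) ≠ 0) {σ : Fin (d + 1) → ℤ}
    (hσ : ∀ i j, (Ψ i).coeff j = lastCoeff (Ψ i) * σ j) : IsNondegenerateSystem (fibreSystem Ψ 0) :=
  isNondegenerateSystem_fibreSystem Ψ ha fun _ _ hij => discForm_eval_ne_zero hΨ ha hσ 0 hij

end Summit.Parity.GeneralizedHardyLittlewood.ConstellationCubesFibreTranslation
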